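import Literature.Geometry.Lorentzian.InteriorKerrGluing
import Literature.Geometry.Lorentzian.KerrDataSchwarzschildExtrinsic
import Literature.Geometry.Lorentzian.SchwarzschildKerrSchildComponents
import Literature.Geometry.Lorentzian.KerrEnergyIdentity
import Literature.Geometry.Lorentzian.UnitNormalUniqueness
import Literature.Geometry.Lorentzian.LeviCivitaProofs
import HarnessLib

/-!
# Interior Kerr gluing (Li–Mei 2020, Prop. 4.1): Step 0 of the printed proof — the Schwarzschild
# data induced on the cylinder `{r = r₀ < 2M}` inside the black hole, in closed form

Support file (all results proved; no named facts) for the named fact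
`LiMei.interiorKerrGluing` (`InteriorKerrGluing.lean`; J. Li, H. Mei, *A construction of
collapsing spacetimes in vacuum*, Comm. Math. Phys. 378 (2020) = arXiv:2005.01249, Prop. 4.1).
The printed proof (§4, pp. 22–25) opens by "recalling" the explicit reference data — their
display **(4.1)**: the Schwarzschild initial data induced on the slice `{r = r₀ < 2m}` are

  `ḡ_m = (2m/r₀ − 1) dt² + r₀² dΩ²`,
  `k̄_m = m r₀⁻² (2m/r₀ − 1)^{1/2} dt² − r₀ (2m/r₀ − 1)^{1/2} dΩ²`

— everything downstream (the cokernel `span{∂_t, Ωᵢ}`, the boundary integrals `𝓘_α`, the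
degree argument) is computed from these components. This file proves (4.1) in the vocabulary in
which the fact is stated: for the PINNED FRAME of `LiMei.NearSchwarzschildCylinder` — any map
`ψ : Kerr.slice 0 1 → Kerr.region 0 r₁` with `(ψ y : E4) = schwCylMap r₀ τ₀ y`
(`t* = ‖y‖ + τ₀`, `x⃗ = r₀ y/‖y‖`) into the ingoing Kerr–Schild chart of Schwarzschild(`M`), and
any future unit normal `ν` of it — one has, with `s(v) = ⟪y, v⟫/‖y‖` (`= dt(v)`, `t = ‖y‖`) and
the round form `Ω(v, w) = (⟪v, w⟫ − ⟪y, v⟫⟪y, w⟫/‖y‖²)/‖y‖²` (`= dΩ²` pulled back by `y ↦ y/‖y‖`):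

* `LiMei.pullbackBilin_schwCyl` — **(4.1a)** `ψ^* g_{M,0} = gbarRep M r₀`,
  `gbarRep M r₀ y v w = (2M/r₀ − 1) s(v) s(w) + r₀² Ω(v, w)`;
* `LiMei.isSpacelikeImmersion_schwCyl` — for `0 < r₀ < 2M` the frame is a smooth spacelike
  immersion ("the hypersurface `r = r₀` is a spacelike hypersurface inside the black hole", p. 22);
* `LiMei.isFutureUnitNormal_schwCylNormal`, `LiMei.eq_schwCylNormalRep` — the future unit normal
  is `ν = (2M/r₀ − 1)^{-1/2} ((2M/r₀) ∂_{t*} + (1 − 2M/r₀) (0, y/‖y‖))`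
  (`= −(2M/r₀ − 1)^{1/2} ∂_r` on `{r = r₀}`: `g♯dr = (2M/r) ∂_{t*} + (1 − 2M/r) ∂_r` in ingoing
  Kerr–Schild coordinates), and it is the only one (codimension one, `UnitNormalUniqueness.lean`);
* `LiMei.secondFundamentalForm_schwCyl` — **(4.1b)** `K_ν(ψ) = kbarRep M r₀`,
  `kbarRep M r₀ y v w = M r₀⁻² (2M/r₀ − 1)^{1/2} s(v) s(w) − r₀ (2M/r₀ − 1)^{1/2} Ω(v, w)`, in the
  tree's sign convention (h) `K_ν(v, w) = + g(D_v ν, dψ w)` with the FUTURE normal (which is the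
  convention of (4.1): `k̄_m(∂_t, ∂_t) = −(2m/r₀ − 1)^{1/2} · ½ ∂_r g_tt = m r₀⁻² (2m/r₀ − 1)^{1/2}`
  for `ν = −(2m/r₀ − 1)^{1/2} ∂_r`, future-pointing inside the black hole);
* `LiMei.kerrBox` — the elementary fact behind the conclusion "inside the black hole with
  parameters `(m, a⃗)`" of Prop. 4.1: for `0 < r₀ < 2M` every parameter in a small box
  `|m − M| + |a| ≤ δ` is subextremal with `r₋(m, a) < r₀ < r₊(m, a)`;
* `LiMei.nearSchwarzschildCylinder_iff` — **the hypothesis of Prop. 4.1 in closed form**: for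
  `r₁ < r₀`, `0 < r₀ < 2M`, `1 ≤ ρ₁`, `NearSchwarzschildCylinder M r₁ r₀ ρ₁ ρ₂ k ε D` holds iff
  every Cartesian derivative of order `≤ k` of `h(v, w) − gbarRep M r₀ (v, w)` and of
  `k(v, w) − kbarRep M r₀ (v, w)` is `≤ ε` in norm on the annulus (unit test vectors) — the frame
  clauses, the `∃ ν`, the `if … else 0` device and the Levi-Civita binder of the definition are all
  discharged (`PseudoRiemannianMetric.hasLeviCivita`, locality of `iteratedFDeriv`), leaving
  exactly Li–Mei's `‖(ḡ, k̄) − (ḡ_{m₀}, k̄_{m₀})‖ < ε` against the explicit tensors (4.1);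
* §7, rotated frames `schwCylMap r₀ τ₀ ∘ R` = the zero-spin Kerr cylinder `kerrCylMap r₀ 0 τ₀ R`
  (`kerrCylMap_zero_spin`): (4.1a)/(4.1b) again (`pullbackBilin_schwCyl_comp`,
  `secondFundamentalForm_schwCyl_comp`, by rotation invariance `gbarRep_isometry`/`kbarRep_isometry`),
  hence `IsKerrCylinderOn.eq_gbarRep_kbarRep_of_zero_spin`: exact zero-spin Kerr-cylinder data ARE
  the tensors (4.1).

Method: the coordinate formulas of `ChartCalculus.lean` / `ChartSecondFundamentalForm.lean`
(`OpensChart.mfderiv_apply_of_repr`, `OpensChart.secondFundamentalForm_eq_of_repr`: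
`K_ν(v, w) = g(DN v + Γ(N)(DΦ v), DΦ w)`, `g(Γ(Z)(Y), W) = ½ K(Z, Y, W)`), the closed forms of
the Schwarzschild Kerr–Schild components and of their first derivatives through the atoms
`ℓ(V) = V⁰ + ⟪x⃗, V⃗⟫/r`, `P(V, W)` (`SchwarzschildKerrSchildComponents.lean`), and the explicit
differential `schwCylDeriv` of the cylinder map; on the cylinder the tangent vectors `dΦ v` have
`ℓ(dΦ v) = s(v)` and spatial part orthogonal to `x⃗`, which collapses every term.

## References

* J. Li, H. Mei, *A construction of collapsing spacetimes in vacuum*, Comm. Math. Phys. 378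
  (2020) 1343–1389, arXiv:2005.01249, §4, (4.1) and Prop. 4.1 (key `LiMei2020`).
* B. O'Neill, *Semi-Riemannian geometry* (1983), Ch. 3, Prop. 3.13; Ch. 4, Lemma 4.1, 4.4
  (key `ONeill1983`); *The geometry of Kerr black holes* (1995), Ch. 2, §2.3 (key `ONeill1995`).
* M. Visser, *The Kerr spacetime: a brief introduction*, arXiv:0706.0622, (32)–(35)
  (key `arXiv07060622`).
* R. M. Wald, *General Relativity* (1984), (10.2.13) (key `Wald1984`).
-/

noncomputable section

open Bundle Set TopologicalSpace Manifold Module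
open scoped Manifold ContDiff Topology RealInnerProductSpace

namespace Literature.Geometry.Lorentzian

namespace LiMei

/-! ### §1 The parameter box: small `(m − M, a)` is subextremal with `r₋ < r₀ < r₊` -/

/-- **The Kerr parameter box of Prop. 4.1 lies inside the black-hole range of the cylinder.**
For `0 < r₀ < 2M` there is `δ > 0` such that every `(m, a)` with `|m − M| + |a| ≤ δ` is
subextremal, `|a| < m`, and the cylinder radius satisfies `r₋(m, a) < r₀ < r₊(m, a)` — so that
"the Kerr initial data induced on the slice `r = r₀` inside the black hole with parameters
`(m, a⃗)`", `|m − m₀| + |a⃗| ≤ C₀ε` (Li–Mei arXiv:2005.01249, Prop. 4.1 and its proof, p. 22),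
makes sense for `ε` small. Elementary: `√(m² − a²) ≥ m − |a|` gives `r₊ ≥ 2m − |a|` and
`r₋ ≤ |a|`; take `δ = min(M/4, (2M − r₀)/4, r₀/2)`. O'Neill 1995, Ch. 2, §2.3 (`r± = m ± √(m² − a²)`).
[cite: LiMei2020, Prop. 4.1] -/
theorem kerrBox {M r₀ : ℝ} (hr₀ : 0 < r₀) (h2M : r₀ < 2 * M) :
    ∃ δ : ℝ, 0 < δ ∧ ∀ m a : ℝ, |m - M| + |a| ≤ δ →
      |a| < m ∧ Kerr.rMinus m a < r₀ ∧ r₀ < Kerr.rPlus m a := by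
  have hM : 0 < M := by linarith
  refine ⟨min (M / 4) (min ((2 * M - r₀) / 4) (r₀ / 2)), by positivity, fun m a hma ↦ ?_⟩
  have hδ1 : min (M / 4) (min ((2 * M - r₀) / 4) (r₀ / 2)) ≤ M / 4 := min_le_left _ _
  have hδ2 : min (M / 4) (min ((2 * M - r₀) / 4) (r₀ / 2)) ≤ (2 * M - r₀) / 4 :=
    (min_le_right _ _).trans (min_le_left _ _)
  have hδ3 : min (M / 4) (min ((2 * M - r₀) / 4) (r₀ / 2)) ≤ r₀ / 2 :=
    (min_le_right _ _).trans (min_le_right _ _)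
  have ha0 : 0 ≤ |a| := abs_nonneg a
  have hmM : |m - M| ≤ M / 4 := by linarith
  have hm : 3 * M / 4 ≤ m := by
    have := neg_abs_le (m - M)
    linarith
  have ham : |a| < m := by linarith [abs_nonneg (m - M)]
  have hm0 : 0 < m := ha0.trans_lt ham
  -- `√(m² − a²) ≥ m − |a|`
  have hsq : m - |a| ≤ √(m ^ 2 - a ^ 2) := by
    have h1 : 0 ≤ m - |a| := by linarith
    have h2 : (m - |a|) ^ 2 ≤ m ^ 2 - a ^ 2 := by
      have : a ^ 2 = |a| ^ 2 := (sq_abs a).symm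
      nlinarith
    calc m - |a| = √((m - |a|) ^ 2) := (Real.sqrt_sq h1).symm
      _ ≤ √(m ^ 2 - a ^ 2) := Real.sqrt_le_sqrt h2
  refine ⟨ham, ?_, ?_⟩
  · -- `r₋ = m − √(m² − a²) ≤ |a| ≤ δ < r₀`
    unfold Kerr.rMinus
    linarith [abs_nonneg (m - M)]
  · -- `r₊ = m + √(m² − a²) ≥ 2m − |a| ≥ 2M − 3δ > r₀`
    unfold Kerr.rPlus
    have := neg_abs_le (m - M)
    linarith [abs_nonneg (m - M)]

/-! ### §2 Calculus of the model cylinder map `y ↦ (‖y‖ + τ₀, r₀ y/‖y‖)` -/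

/-- The cylinder map splits as `(‖y‖ + τ₀) ∂_{t*} + (0, (r₀/‖y‖) y)`. [folklore] -/
theorem schwCylMap_eq (r₀ τ₀ : ℝ) (y : E3) :
    schwCylMap r₀ τ₀ y = (‖y‖ + τ₀) • E4.basisVector 0 + E4.spaceEmbed ((r₀ / ‖y‖) • y) := by
  rw [schwCylMap, E4.ofTimeSpace_eq_smul_add']

/-- The time component of the cylinder map is `t* = ‖y‖ + τ₀`. [folklore] -/
@[simp]
theorem schwCylMap_apply_zero (r₀ τ₀ : ℝ) (y : E3) : schwCylMap r₀ τ₀ y 0 = ‖y‖ + τ₀ := by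
  simp [schwCylMap]

/-- The spatial part of the cylinder map is `x⃗ = (r₀/‖y‖) y`. [folklore] -/
@[simp]
theorem spatial_schwCylMap (r₀ τ₀ : ℝ) (y : E3) :
    E4.spatial (schwCylMap r₀ τ₀ y) = (r₀ / ‖y‖) • y := by
  simp [schwCylMap]

/-- On `{y ≠ 0}` the cylinder map has spatial radius `‖x⃗‖ = r₀` (`0 < r₀`). [folklore] -/
theorem spatialNorm_schwCylMap {r₀ : ℝ} (hr₀ : 0 < r₀) (τ₀ : ℝ) {y : E3} (hy : y ≠ 0) :
    E4.spatialNorm (schwCylMap r₀ τ₀ y) = r₀ := by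
  rw [← Kerr.radius_zero_left, radius_schwCylMap hr₀ τ₀ hy]

/-- Off the origin the cylinder map stays off the time axis (`r₀ ≠ 0`). [folklore] -/
theorem spatial_schwCylMap_ne_zero {r₀ : ℝ} (hr₀ : r₀ ≠ 0) (τ₀ : ℝ) {y : E3} (hy : y ≠ 0) :
    E4.spatial (schwCylMap r₀ τ₀ y) ≠ 0 := by
  rw [spatial_schwCylMap]
  exact smul_ne_zero (div_ne_zero hr₀ (norm_ne_zero_iff.2 hy)) hy

/-- **The differential of the cylinder map** at `y ≠ 0`, as a continuous linear map `E3 →L E4`: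
`v ↦ (⟪y, v⟫/‖y‖) ∂_{t*} + (0, (r₀/‖y‖) v − (r₀ ⟪y, v⟫/‖y‖³) y)` (`d‖y‖ = ⟪y, ·⟫/‖y‖`,
`d(y/‖y‖) = (v − ⟪y, v⟫ y/‖y‖²)/‖y‖`). [folklore] -/
def schwCylDeriv (r₀ : ℝ) (y : E3) : E3 →L[ℝ] E4 :=
  (‖y‖⁻¹ • E3.covec y).smulRight (E4.basisVector 0) +
    E4.spaceEmbed.comp ((r₀ / ‖y‖) • ContinuousLinearMap.id ℝ E3 +
      ((-r₀ / ‖y‖ ^ 3) • E3.covec y).smulRight y)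

/-- `schwCylDeriv r₀ y v = (⟪y, v⟫/‖y‖) ∂_{t*} + (0, (r₀/‖y‖) v + (−r₀ ⟪y, v⟫/‖y‖³) y)`.
[folklore] -/
theorem schwCylDeriv_apply (r₀ : ℝ) (y v : E3) :
    schwCylDeriv r₀ y v = (‖y‖⁻¹ * ⟪y, v⟫) • E4.basisVector 0 +
      E4.spaceEmbed ((r₀ / ‖y‖) • v + (-r₀ / ‖y‖ ^ 3 * ⟪y, v⟫) • y) := by
  simp only [schwCylDeriv, add_apply, ContinuousLinearMap.smulRight_apply, smul_apply,
    E3.covec_apply, smul_eq_mul, ContinuousLinearMap.comp_apply, ContinuousLinearMap.id_apply]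

/-- The time component of `dΦ v` is `dt(v) = ⟪y, v⟫/‖y‖`. [folklore] -/
@[simp]
theorem schwCylDeriv_apply_zero (r₀ : ℝ) (y v : E3) :
    schwCylDeriv r₀ y v 0 = ‖y‖⁻¹ * ⟪y, v⟫ := by
  rw [schwCylDeriv_apply]
  simp

/-- The spatial part of `dΦ v` is `(r₀/‖y‖) v − (r₀ ⟪y, v⟫/‖y‖³) y`. [folklore] -/
@[simp]
theorem spatial_schwCylDeriv (r₀ : ℝ) (y v : E3) :
    E4.spatial (schwCylDeriv r₀ y v) = (r₀ / ‖y‖) • v + (-r₀ / ‖y‖ ^ 3 * ⟪y, v⟫) • y := by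
  rw [schwCylDeriv_apply]
  simp

/-- **The cylinder map is differentiable off the origin, with differential `schwCylDeriv r₀ y`.**
[folklore] -/
theorem hasFDerivAt_schwCylMap (r₀ τ₀ : ℝ) {y : E3} (hy : y ≠ 0) :
    HasFDerivAt (schwCylMap r₀ τ₀) (schwCylDeriv r₀ y) y := by
  have hfun : schwCylMap r₀ τ₀ =
      fun y : E3 ↦ (‖y‖ + τ₀) • E4.basisVector 0 + E4.spaceEmbed ((r₀ / ‖y‖ ^ 1) • y) := by
    funext z; rw [schwCylMap_eq, pow_one]
  rw [hfun]
  have h1 : HasFDerivAt (fun y : E3 ↦ (‖y‖ + τ₀) • E4.basisVector 0)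
      ((‖y‖⁻¹ • E3.covec y).smulRight (E4.basisVector 0)) y :=
    ((Kerr.hasFDerivAt_norm_E3 hy).add_const τ₀).smul_const _
  have h2 : HasFDerivAt (fun y : E3 ↦ (r₀ / ‖y‖ ^ 1) • y)
      ((r₀ / ‖y‖ ^ 1) • ContinuousLinearMap.id ℝ E3 +
        ((-(r₀ * (1 : ℕ)) / ‖y‖ ^ (1 + 2)) • E3.covec y).smulRight y) y :=
    (Kerr.hasFDerivAt_const_div_norm_pow r₀ hy 1).smul (hasFDerivAt_id y)
  have h3 := E4.spaceEmbed.hasFDerivAt.comp y h2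
  refine (h1.add h3).congr_fderiv ?_
  simp only [schwCylDeriv, pow_one, Nat.cast_one, mul_one]

/-- The cylinder map is differentiable off the origin. [folklore] -/
theorem differentiableAt_schwCylMap (r₀ τ₀ : ℝ) {y : E3} (hy : y ≠ 0) :
    DifferentiableAt ℝ (schwCylMap r₀ τ₀) y :=
  (hasFDerivAt_schwCylMap r₀ τ₀ hy).differentiableAt

/-- `DΦ(y) = schwCylDeriv r₀ y` off the origin. [folklore] -/
theorem fderiv_schwCylMap (r₀ τ₀ : ℝ) {y : E3} (hy : y ≠ 0) :
    fderiv ℝ (schwCylMap r₀ τ₀) y = schwCylDeriv r₀ y :=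
  (hasFDerivAt_schwCylMap r₀ τ₀ hy).fderiv

/-- **The cylinder map is `C^n` off the origin** for every `n` (the norm is smooth off `0`).
[folklore] -/
theorem contDiffAt_schwCylMap (r₀ τ₀ : ℝ) {y : E3} (hy : y ≠ 0) {n : WithTop ℕ∞} :
    ContDiffAt ℝ n (schwCylMap r₀ τ₀) y := by
  have hfun : schwCylMap r₀ τ₀ =
      fun y : E3 ↦ (‖y‖ + τ₀) • E4.basisVector 0 + E4.spaceEmbed ((r₀ / ‖y‖) • y) := by
    funext z; rw [schwCylMap_eq]
  rw [hfun]
  have hn : ContDiffAt ℝ n (fun y : E3 ↦ ‖y‖) y := contDiffAt_norm ℝ hy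
  have h1 : ContDiffAt ℝ n (fun y : E3 ↦ (‖y‖ + τ₀) • E4.basisVector 0) y :=
    (hn.add contDiffAt_const).smul contDiffAt_const
  have h2 : ContDiffAt ℝ n (fun y : E3 ↦ (r₀ / ‖y‖) • y) y :=
    (contDiffAt_const.div hn (norm_ne_zero_iff.2 hy)).smul contDiffAt_id
  exact h1.add (E4.spaceEmbed.contDiff.contDiffAt.comp y h2)


/-! ### §3 (4.1a) The induced metric of the Schwarzschild cylinder -/

/-- **The Schwarzschild cylinder metric as a function on `E3`** (Li–Mei (4.1a) transported along
`y ↦ (‖y‖ + τ₀, r₀ y/‖y‖)`): `gbarRep M r₀ y v w = (2M/r₀ − 1) s(v) s(w) + r₀² Ω(v, w)` with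
`s(v) = ⟪y, v⟫/‖y‖` (`dt`, `t = ‖y‖`) and `Ω(v, w) = (⟪v, w⟫ − ⟪y, v⟫⟪y, w⟫/‖y‖²)/‖y‖²` (the round
metric `dΩ²` pulled back by `y ↦ y/‖y‖`), i.e. `ḡ_m = (2m/r₀ − 1) dt² + r₀² dΩ²` in the polar
coordinates `(t, ω) = (‖y‖, y/‖y‖)` of the annulus. Li–Mei arXiv:2005.01249, (4.1).
[cite: LiMei2020, (4.1)] -/
def gbarRep (M r₀ : ℝ) (y v w : E3) : ℝ :=
  (2 * M / r₀ - 1) * (⟪y, v⟫ * ⟪y, w⟫ / ‖y‖ ^ 2) +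
    r₀ ^ 2 / ‖y‖ ^ 2 * (⟪v, w⟫ - ⟪y, v⟫ * ⟪y, w⟫ / ‖y‖ ^ 2)

/-- `gbarRep M r₀ y` is symmetric. [cite: LiMei2020, (4.1)] -/
theorem gbarRep_symm (M r₀ : ℝ) (y v w : E3) : gbarRep M r₀ y v w = gbarRep M r₀ y w v := by
  rw [gbarRep, gbarRep, real_inner_comm v w, mul_comm ⟪y, v⟫]

/-- **The pointwise computation behind (4.1a)**: at `x = (‖y‖ + τ₀, r₀ y/‖y‖)` the Schwarzschild
Kerr–Schild form `g = η + (2M/r) ℓ ⊗ ℓ` evaluated on two tangent vectors `dΦ v`, `dΦ w` of the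
cylinder is `gbarRep M r₀ y v w`: the spatial parts of `dΦ v` are orthogonal to `x⃗`, so
`ℓ(dΦ v) = dt*(dΦ v) = s(v)`, `η(dΦ v, dΦ w) = −s(v)s(w) + r₀² Ω(v, w)` and `r = r₀`.
[cite: LiMei2020, (4.1)] -/
theorem bilin_schwCylDeriv (M : ℝ) {r₀ : ℝ} (hr₀ : 0 < r₀) (τ₀ : ℝ) {y : E3} (hy : y ≠ 0)
    (v w : E3) :
    Kerr.bilin M 0 (schwCylMap r₀ τ₀ y) (schwCylDeriv r₀ y v) (schwCylDeriv r₀ y w) =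
      gbarRep M r₀ y v w := by
  have hn : ‖y‖ ≠ 0 := norm_ne_zero_iff.2 hy
  have hsp : E4.spatialNorm (schwCylMap r₀ τ₀ y) ≠ 0 := by
    rw [spatialNorm_schwCylMap hr₀ τ₀ hy]; exact hr₀.ne'
  rw [Kerr.bilin_zero_spin_apply M hsp, spatialNorm_schwCylMap hr₀ τ₀ hy]
  simp only [schwCylDeriv_apply_zero, spatial_schwCylDeriv, spatial_schwCylMap, inner_add_left,
    inner_add_right, inner_smul_left, inner_smul_right, real_inner_self_eq_norm_sq,
    real_inner_comm v y, real_inner_comm w y, real_inner_comm w v, conj_trivial, gbarRep]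
  field_simp
  ring

/-- **(4.1a), the induced metric of the pinned Schwarzschild cylinder frame.** For any map
`ψ : Kerr.slice 0 1 → Kerr.region 0 r₁` with `(ψ y : E4) = schwCylMap r₀ τ₀ y` (`0 < r₀`; the
frame of `LiMei.NearSchwarzschildCylinder`, any time shift `τ₀`), the pullback of the smooth
Schwarzschild metric `Kerr.smoothMetric M 0 r₁` is `ψ^* g = gbarRep M r₀`, i.e.
`ḡ_M = (2M/r₀ − 1) dt² + r₀² dΩ²`. Li–Mei arXiv:2005.01249, (4.1). [cite: LiMei2020, (4.1)] -/
theorem pullbackBilin_schwCyl [Kerr.Facts] {M r₁ r₀ : ℝ} (hr₀ : 0 < r₀) (τ₀ : ℝ)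
    {ψ : Kerr.slice 0 1 → Kerr.region 0 r₁} (hψ : ∀ y, (ψ y : E4) = schwCylMap r₀ τ₀ (y : E3))
    (y : Kerr.slice 0 1) (v w : E3) :
    pullbackBilin (I := 𝓘(ℝ, E4)) (I' := 𝓘(ℝ, E3)) ψ (Kerr.smoothMetric M 0 r₁).val y v w =
      gbarRep M r₀ y v w := by
  have hy : (y : E3) ≠ 0 := ne_zero_of_mem_slice y
  rw [pullbackBilin_apply, OpensChart.mfderiv_apply_of_repr hψ (differentiableAt_schwCylMap r₀ τ₀ hy),
    OpensChart.mfderiv_apply_of_repr hψ (differentiableAt_schwCylMap r₀ τ₀ hy),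
    fderiv_schwCylMap r₀ τ₀ hy, Kerr.smoothMetric_val, hψ y]
  exact bilin_schwCylDeriv M hr₀ τ₀ hy v w

/-- **The cylinder `{r = r₀}` is spacelike inside the black hole**: for `0 < r₀ < 2M` the form
`gbarRep M r₀ y` is positive definite at every `y ≠ 0` (`2M/r₀ − 1 > 0`, and `Ω(v, v) ≥ 0` by
Cauchy–Schwarz with equality only for `v ∥ y`, where `s(v)² > 0`). Li–Mei arXiv:2005.01249, §4,
p. 22 ("for any `r₀ ∈ (r₋, r₊)`, the hypersurface `r = r₀` is a spacelike hypersurface inside the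
black hole"). [cite: LiMei2020, §4] -/
theorem gbarRep_pos {M r₀ : ℝ} (hr₀ : 0 < r₀) (h2M : r₀ < 2 * M) {y : E3} (hy : y ≠ 0) {v : E3}
    (hv : v ≠ 0) : 0 < gbarRep M r₀ y v v := by
  have hn : 0 < ‖y‖ := norm_pos_iff.2 hy
  have hvn : 0 < ‖v‖ := norm_pos_iff.2 hv
  have hμ : 0 < 2 * M / r₀ - 1 := by
    rw [sub_pos, lt_div_iff₀ hr₀]; linarith
  have hcs : ⟪y, v⟫ * ⟪y, v⟫ ≤ ‖y‖ ^ 2 * ‖v‖ ^ 2 := by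
    have h := abs_real_inner_le_norm y v
    have h0 : 0 ≤ |⟪y, v⟫| := abs_nonneg _
    calc ⟪y, v⟫ * ⟪y, v⟫ = |⟪y, v⟫| * |⟪y, v⟫| := (abs_mul_abs_self _).symm
      _ ≤ (‖y‖ * ‖v‖) * (‖y‖ * ‖v‖) := mul_le_mul h h h0 (h0.trans h)
      _ = ‖y‖ ^ 2 * ‖v‖ ^ 2 := by ring
  unfold gbarRep
  rw [real_inner_self_eq_norm_sq]
  have hΩ : 0 ≤ ‖v‖ ^ 2 - ⟪y, v⟫ * ⟪y, v⟫ / ‖y‖ ^ 2 := by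
    rw [sub_nonneg, div_le_iff₀ (by positivity)]
    linarith
  rcases eq_or_ne ⟪y, v⟫ 0 with h0 | h0
  · rw [h0]
    simp only [mul_zero, zero_div, sub_zero, zero_add, mul_pos_iff]
    left
    exact ⟨by positivity, by positivity⟩
  · have h1 : 0 < (2 * M / r₀ - 1) * (⟪y, v⟫ * ⟪y, v⟫ / ‖y‖ ^ 2) := by
      have : 0 < ⟪y, v⟫ * ⟪y, v⟫ := mul_self_pos.2 h0
      positivity
    have h2 : 0 ≤ r₀ ^ 2 / ‖y‖ ^ 2 * (‖v‖ ^ 2 - ⟪y, v⟫ * ⟪y, v⟫ / ‖y‖ ^ 2) :=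
      mul_nonneg (by positivity) hΩ
    linarith

/-- A pinned cylinder frame `ψ` (`(ψ y : E4) = schwCylMap r₀ τ₀ y`) is `C^n` for every `n`, as a
map of manifolds `Kerr.slice 0 1 → Kerr.region 0 r₁` (its composite with the inclusion into `E4`
is the restriction of `schwCylMap r₀ τ₀`, smooth off the origin). [folklore] -/
theorem contMDiff_schwCyl {r₁ r₀ τ₀ : ℝ} {ψ : Kerr.slice 0 1 → Kerr.region 0 r₁}
    (hψ : ∀ y, (ψ y : E4) = schwCylMap r₀ τ₀ (y : E3)) (n : ℕ∞ω) :
    ContMDiff 𝓘(ℝ, E3) 𝓘(ℝ, E4) n ψ := fun y ↦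
  (ChartedSpace.liftPropWithinAt_subtypeVal_comp_iff ψ Set.univ y).mp
    ((OpensChart.contMDiffAt_iff y (Subtype.val ∘ ψ) (schwCylMap r₀ τ₀) (fun z ↦ hψ z)).2
      (contDiffAt_schwCylMap r₀ τ₀ (ne_zero_of_mem_slice y)))

/-- **The pinned Schwarzschild cylinder frame is a smooth spacelike immersion** for
`0 < r₀ < 2M` (the `IsSpacelikeImmersion` clause of `LiMei.NearSchwarzschildCylinder` is
satisfiable, by the model frame itself): smoothness off the origin and positivity of
`ψ^* g = gbarRep M r₀` (`gbarRep_pos`). Li–Mei arXiv:2005.01249, §4, p. 22. [cite: LiMei2020, §4] -/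
theorem isSpacelikeImmersion_schwCyl [Kerr.Facts] {M r₁ r₀ : ℝ} (hr₀ : 0 < r₀) (h2M : r₀ < 2 * M)
    (τ₀ : ℝ) {ψ : Kerr.slice 0 1 → Kerr.region 0 r₁}
    (hψ : ∀ y, (ψ y : E4) = schwCylMap r₀ τ₀ (y : E3)) :
    (Kerr.smoothMetric M 0 r₁).IsSpacelikeImmersion 𝓘(ℝ, E3) ψ := by
  refine ⟨contMDiff_schwCyl hψ _, fun y v hv ↦ ?_⟩
  have h := pullbackBilin_schwCyl (M := M) hr₀ τ₀ hψ y v v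
  rw [pullbackBilin_apply] at h
  rw [PseudoRiemannianMetric.inducedBilin_apply]
  exact h ▸ gbarRep_pos hr₀ h2M (ne_zero_of_mem_slice y) hv


/-! ### §4 The future unit normal of the cylinder -/

/-- **The future unit normal of the Schwarzschild cylinder `{r = r₀ < 2M}`, as a function on `E3`**:
`ν(y) = (2M/r₀ − 1)^{-1/2} ((2M/r₀) ∂_{t*} + (1 − 2M/r₀) (0, y/‖y‖))`. In ingoing Kerr–Schild
coordinates `g♯dr = (2M/r) ∂_{t*} + (1 − 2M/r) ∂_r` with `g(g♯dr, g♯dr) = g^{rr} = 1 − 2M/r < 0`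
inside the hole, and `∂_r = (x⃗/r) · ∂_{x⃗} = (0, y/‖y‖)` on the cylinder; so `ν = −(2M/r₀ − 1)^{1/2} ∂_r`
in Schwarzschild coordinates — the `r`-DECREASING (future, inside the black hole) unit normal for
which Li–Mei's `k̄_m` of (4.1) is `+g(∇_X ν, Y)`. Li–Mei arXiv:2005.01249, §4, (4.1); O'Neill 1995,
Ch. 2, §2.5 (ingoing coordinates). [cite: LiMei2020, (4.1)] -/
def schwCylNormalRep (M r₀ : ℝ) (y : E3) : E4 :=
  (√(2 * M / r₀ - 1))⁻¹ •
    ((2 * M / r₀) • E4.basisVector 0 + (1 - 2 * M / r₀) • E4.spaceEmbed (‖y‖⁻¹ • y))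

/-- The time component of the normal: `ν⁰ = (2M/r₀ − 1)^{-1/2} (2M/r₀)`. [cite: LiMei2020, (4.1)] -/
@[simp]
theorem schwCylNormalRep_apply_zero (M r₀ : ℝ) (y : E3) :
    schwCylNormalRep M r₀ y 0 = (√(2 * M / r₀ - 1))⁻¹ * (2 * M / r₀) := by
  simp [schwCylNormalRep]

/-- The spatial part of the normal: `ν⃗ = (2M/r₀ − 1)^{-1/2} (1 − 2M/r₀) y/‖y‖` (inward for
`r₀ < 2M`). [cite: LiMei2020, (4.1)] -/
@[simp]
theorem spatial_schwCylNormalRep (M r₀ : ℝ) (y : E3) :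
    E4.spatial (schwCylNormalRep M r₀ y) =
      ((√(2 * M / r₀ - 1))⁻¹ * ((1 - 2 * M / r₀) * ‖y‖⁻¹)) • y := by
  simp only [schwCylNormalRep, map_smul, map_add, E4.spaceEmbed_apply, E4.spatial_ofTimeSpace,
    smul_smul]
  have h0 : E4.spatial (E4.basisVector 0) = 0 := Kerr.spatial_basisVector_zero
  rw [h0, smul_zero, zero_add, smul_smul]

/-- **Normality**: `g(ν, dΦ w) = 0` for every tangent vector of the cylinder (`ℓ(ν) = (2M/r₀ − 1)^{-1/2}`,
`ℓ(dΦ w) = s(w)`, `η(ν, dΦ w) = −(2M/r₀ − 1)^{-1/2} (2M/r₀) s(w)`). [cite: LiMei2020, (4.1)] -/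
theorem bilin_schwCylNormalRep_schwCylDeriv (M : ℝ) {r₀ : ℝ} (hr₀ : 0 < r₀) (τ₀ : ℝ) {y : E3}
    (hy : y ≠ 0) (w : E3) :
    Kerr.bilin M 0 (schwCylMap r₀ τ₀ y) (schwCylNormalRep M r₀ y) (schwCylDeriv r₀ y w) = 0 := by
  have hn : ‖y‖ ≠ 0 := norm_ne_zero_iff.2 hy
  have hsp : E4.spatialNorm (schwCylMap r₀ τ₀ y) ≠ 0 := by
    rw [spatialNorm_schwCylMap hr₀ τ₀ hy]; exact hr₀.ne'
  rw [Kerr.bilin_zero_spin_apply M hsp, spatialNorm_schwCylMap hr₀ τ₀ hy]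
  simp only [schwCylDeriv_apply_zero, spatial_schwCylDeriv, spatial_schwCylMap,
    schwCylNormalRep_apply_zero, spatial_schwCylNormalRep, inner_add_right, inner_smul_left,
    inner_smul_right, real_inner_self_eq_norm_sq, real_inner_comm w y, conj_trivial]
  field_simp
  ring

/-- **Unit length**: `g(ν, ν) = −1` for `r₀ < 2M` (`g(ν, ν) = (2M/r₀ − 1)⁻¹ (1 − 2M/r₀)`).
[cite: LiMei2020, (4.1)] -/
theorem bilin_schwCylNormalRep_self (M : ℝ) {r₀ : ℝ} (hr₀ : 0 < r₀) (h2M : r₀ < 2 * M) (τ₀ : ℝ)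
    {y : E3} (hy : y ≠ 0) :
    Kerr.bilin M 0 (schwCylMap r₀ τ₀ y) (schwCylNormalRep M r₀ y) (schwCylNormalRep M r₀ y) = -1 := by
  have hn : ‖y‖ ≠ 0 := norm_ne_zero_iff.2 hy
  have hμ : 0 < 2 * M / r₀ - 1 := by
    rw [sub_pos, lt_div_iff₀ hr₀]; linarith
  have hs : √(2 * M / r₀ - 1) ^ 2 = 2 * M / r₀ - 1 := Real.sq_sqrt hμ.le
  have hs0 : √(2 * M / r₀ - 1) ≠ 0 := (Real.sqrt_pos.2 hμ).ne'
  have hsp : E4.spatialNorm (schwCylMap r₀ τ₀ y) ≠ 0 := by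
    rw [spatialNorm_schwCylMap hr₀ τ₀ hy]; exact hr₀.ne'
  rw [Kerr.bilin_zero_spin_apply M hsp, spatialNorm_schwCylMap hr₀ τ₀ hy]
  simp only [spatial_schwCylMap, schwCylNormalRep_apply_zero, spatial_schwCylNormalRep,
    inner_smul_left, inner_smul_right, real_inner_self_eq_norm_sq, conj_trivial]
  set s := √(2 * M / r₀ - 1) with hs_def
  have hs' : s ^ 2 * r₀ = 2 * M - r₀ := by
    rw [hs]; field_simp
  field_simp
  linear_combination r₀ ^ 2 * hs'

/-- **Future-directedness**: `g(V, ν) = −ν⁰ = −(2M/r₀ − 1)^{-1/2} (2M/r₀) < 0` for the Kerr time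
orientation `V = −g♯dt*` (`g(V, ·) = −dt*`). [cite: LiMei2020, (4.1)] -/
theorem bilin_timeVector_schwCylNormalRep {M r₀ : ℝ} (hr₀ : 0 < r₀) (h2M : r₀ < 2 * M) (τ₀ : ℝ)
    {y : E3} (hy : y ≠ 0) :
    Kerr.bilin M 0 (schwCylMap r₀ τ₀ y) (Kerr.timeVector M 0 (schwCylMap r₀ τ₀ y))
      (schwCylNormalRep M r₀ y) < 0 := by
  have hM : 0 < M := by linarith
  have hμ : 0 < 2 * M / r₀ - 1 := by
    rw [sub_pos, lt_div_iff₀ hr₀]; linarith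
  have hx : 0 < Kerr.radius 0 (schwCylMap r₀ τ₀ y) := by
    rw [radius_schwCylMap hr₀ τ₀ hy]; exact hr₀
  rw [Kerr.bilin_timeVector hx, schwCylNormalRep_apply_zero, neg_lt_zero]
  have : 0 < (√(2 * M / r₀ - 1))⁻¹ := inv_pos.2 (Real.sqrt_pos.2 hμ)
  positivity

/-- `dim E4 = dim E3 + 1` (the cylinder is a hypersurface). [folklore] -/
theorem finrank_E4_eq : finrank ℝ E4 = finrank ℝ E3 + 1 := by
  rw [finrank_euclideanSpace_fin, finrank_euclideanSpace_fin]

/-- **The future unit normal of the pinned Schwarzschild cylinder frame** (`0 ≤ M` for the time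
orientation, `0 < r₀ < 2M`): `y ↦ schwCylNormalRep M r₀ y` is a unit normal of sign `−1` along
`ψ`, future-directed for `Kerr.timeOrientation` (the `IsFutureUnitNormal` clause of
`LiMei.NearSchwarzschildCylinder` is satisfiable). Li–Mei arXiv:2005.01249, §4, (4.1); Wald 1984,
§10.2. [cite: LiMei2020, (4.1)] -/
theorem isFutureUnitNormal_schwCylNormal [Kerr.Facts] {M r₁ r₀ : ℝ} (hM : 0 ≤ M) (hr₀ : 0 < r₀)
    (h2M : r₀ < 2 * M) (τ₀ : ℝ) {ψ : Kerr.slice 0 1 → Kerr.region 0 r₁}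
    (hψ : ∀ y, (ψ y : E4) = schwCylMap r₀ τ₀ (y : E3)) :
    (Kerr.smoothMetric M 0 r₁).IsFutureUnitNormal 𝓘(ℝ, E3)
      ((Kerr.timeOrientation M 0 r₁ hM).ofLE le_top) ψ
      (fun y ↦ schwCylNormalRep M r₀ (y : E3)) := by
  have hunit : ∀ y : Kerr.slice 0 1, (Kerr.smoothMetric M 0 r₁).val (ψ y)
      (schwCylNormalRep M r₀ (y : E3)) (schwCylNormalRep M r₀ (y : E3)) = -1 := fun y ↦ by
    rw [Kerr.smoothMetric_val, hψ y]
    exact bilin_schwCylNormalRep_self M hr₀ h2M τ₀ (ne_zero_of_mem_slice y)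
  refine ⟨⟨fun y v ↦ ?_, hunit⟩, fun y ↦ ⟨?_, ?_⟩⟩
  · -- normal
    have hy : (y : E3) ≠ 0 := ne_zero_of_mem_slice y
    rw [OpensChart.mfderiv_apply_of_repr hψ (differentiableAt_schwCylMap r₀ τ₀ hy),
      fderiv_schwCylMap r₀ τ₀ hy, Kerr.smoothMetric_val, hψ y]
    exact bilin_schwCylNormalRep_schwCylDeriv M hr₀ τ₀ hy v
  · -- causal
    have ht : (Kerr.smoothMetric M 0 r₁).IsTimelike (x := ψ y)
        (schwCylNormalRep M r₀ (y : E3)) := by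
      rw [LorentzianMetric.isTimelike_iff]
      have h := hunit y
      exact h ▸ neg_one_lt_zero
    exact ht.isCausal
  · -- future
    rw [TimeOrientation.vectorField_ofLE, Kerr.smoothMetric_val]
    show Kerr.bilin M 0 (ψ y : E4) (Kerr.timeVector M 0 (ψ y : E4))
      (schwCylNormalRep M r₀ (y : E3)) < 0
    rw [hψ y]
    exact bilin_timeVector_schwCylNormalRep hr₀ h2M τ₀ (ne_zero_of_mem_slice y)

/-- **Uniqueness: every future unit normal of the pinned cylinder frame is `schwCylNormalRep`.**
The frame is a codimension-one spacelike immersion, so its future unit normal is unique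
(`LorentzianMetric.IsFutureUnitNormal.apply_eq`, O'Neill 1983, Ch. 5, p. 145); in particular the
`∃ ν` of `LiMei.NearSchwarzschildCylinder` pins `ν` pointwise. [cite: LiMei2020, (4.1)] -/
theorem eq_schwCylNormalRep [Kerr.Facts] {M r₁ r₀ : ℝ} (hM : 0 ≤ M) (hr₀ : 0 < r₀)
    (h2M : r₀ < 2 * M) (τ₀ : ℝ) {ψ : Kerr.slice 0 1 → Kerr.region 0 r₁}
    (hψ : ∀ y, (ψ y : E4) = schwCylMap r₀ τ₀ (y : E3)) {ν : NormalField 𝓘(ℝ, E4) ψ}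
    (hν : (Kerr.smoothMetric M 0 r₁).IsFutureUnitNormal 𝓘(ℝ, E3)
      ((Kerr.timeOrientation M 0 r₁ hM).ofLE le_top) ψ ν) (y : Kerr.slice 0 1) :
    ν y = schwCylNormalRep M r₀ (y : E3) :=
  (isFutureUnitNormal_schwCylNormal hM hr₀ h2M τ₀ hψ).apply_eq finrank_E4_eq
    (isSpacelikeImmersion_schwCyl hr₀ h2M τ₀ hψ) hν y


/-! ### §5 (4.1b) The second fundamental form of the Schwarzschild cylinder -/

/-- **The Schwarzschild cylinder second fundamental form as a function on `E3`** (Li–Mei (4.1b)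
transported): `kbarRep M r₀ y v w = M r₀⁻² (2M/r₀ − 1)^{1/2} s(v) s(w) − r₀ (2M/r₀ − 1)^{1/2} Ω(v, w)`,
i.e. `k̄_m = m r₀⁻² (2m/r₀ − 1)^{1/2} dt² − r₀ (2m/r₀ − 1)^{1/2} dΩ²` in the polar coordinates
`(t, ω) = (‖y‖, y/‖y‖)`, with respect to the future (`r`-decreasing) unit normal and the sign
convention `K(X, Y) = +g(∇_X ν, Y)` (both as in the print). Li–Mei arXiv:2005.01249, (4.1).
[cite: LiMei2020, (4.1)] -/
def kbarRep (M r₀ : ℝ) (y v w : E3) : ℝ :=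
  M / r₀ ^ 2 * √(2 * M / r₀ - 1) * (⟪y, v⟫ * ⟪y, w⟫ / ‖y‖ ^ 2) -
    r₀ * √(2 * M / r₀ - 1) / ‖y‖ ^ 2 * (⟪v, w⟫ - ⟪y, v⟫ * ⟪y, w⟫ / ‖y‖ ^ 2)

/-- `kbarRep M r₀ y` is symmetric. [cite: LiMei2020, (4.1)] -/
theorem kbarRep_symm (M r₀ : ℝ) (y v w : E3) : kbarRep M r₀ y v w = kbarRep M r₀ y w v := by
  rw [kbarRep, kbarRep, real_inner_comm v w, mul_comm ⟪y, v⟫]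

/-- The differential of the normal `y ↦ ν(y)`: only `y/‖y‖` varies,
`Dν(y) v = (2M/r₀ − 1)^{-1/2} (1 − 2M/r₀) (0, v/‖y‖ − ⟪y, v⟫ y/‖y‖³)`, as a continuous linear map.
[folklore] -/
def schwCylNormalDeriv (M r₀ : ℝ) (y : E3) : E3 →L[ℝ] E4 :=
  ((√(2 * M / r₀ - 1))⁻¹ * (1 - 2 * M / r₀)) •
    E4.spaceEmbed.comp (‖y‖⁻¹ • ContinuousLinearMap.id ℝ E3 +
      ((-1 / ‖y‖ ^ 3) • E3.covec y).smulRight y)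

/-- `Dν(y) v = (2M/r₀ − 1)^{-1/2} (1 − 2M/r₀) (0, ‖y‖⁻¹ v + (−⟪y, v⟫/‖y‖³) y)`. [folklore] -/
theorem schwCylNormalDeriv_apply (M r₀ : ℝ) (y v : E3) :
    schwCylNormalDeriv M r₀ y v = ((√(2 * M / r₀ - 1))⁻¹ * (1 - 2 * M / r₀)) •
      E4.spaceEmbed (‖y‖⁻¹ • v + (-1 / ‖y‖ ^ 3 * ⟪y, v⟫) • y) := by
  simp only [schwCylNormalDeriv, smul_apply, ContinuousLinearMap.comp_apply, add_apply,
    ContinuousLinearMap.id_apply, ContinuousLinearMap.smulRight_apply, E3.covec_apply, smul_eq_mul]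

/-- `Dν(y) v` has no time component. [folklore] -/
@[simp]
theorem schwCylNormalDeriv_apply_zero (M r₀ : ℝ) (y v : E3) : schwCylNormalDeriv M r₀ y v 0 = 0 := by
  rw [schwCylNormalDeriv_apply]
  simp

/-- The spatial part of `Dν(y) v`. [folklore] -/
@[simp]
theorem spatial_schwCylNormalDeriv (M r₀ : ℝ) (y v : E3) :
    E4.spatial (schwCylNormalDeriv M r₀ y v) = ((√(2 * M / r₀ - 1))⁻¹ * (1 - 2 * M / r₀)) •
      (‖y‖⁻¹ • v + (-1 / ‖y‖ ^ 3 * ⟪y, v⟫) • y) := by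
  rw [schwCylNormalDeriv_apply]
  simp

/-- **The normal is differentiable off the origin, with differential `schwCylNormalDeriv`.**
[folklore] -/
theorem hasFDerivAt_schwCylNormalRep (M r₀ : ℝ) {y : E3} (hy : y ≠ 0) :
    HasFDerivAt (schwCylNormalRep M r₀) (schwCylNormalDeriv M r₀ y) y := by
  have hfun : schwCylNormalRep M r₀ = fun y : E3 ↦ (√(2 * M / r₀ - 1))⁻¹ •
      ((2 * M / r₀) • E4.basisVector 0 + (1 - 2 * M / r₀) • E4.spaceEmbed ((‖y‖ ^ 1)⁻¹ • y)) := by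
    funext z; rw [schwCylNormalRep, pow_one]
  rw [hfun]
  have h1 : HasFDerivAt (fun y : E3 ↦ (‖y‖ ^ 1)⁻¹ • y)
      ((‖y‖ ^ 1)⁻¹ • ContinuousLinearMap.id ℝ E3 +
        (((-(1 : ℕ) : ℝ) / ‖y‖ ^ (1 + 2)) • E3.covec y).smulRight y) y :=
    (Kerr.hasFDerivAt_inv_norm_pow hy 1).smul (hasFDerivAt_id y)
  have h2 := ((E4.spaceEmbed.hasFDerivAt.comp y h1).const_smul (1 - 2 * M / r₀)).const_add
    ((2 * M / r₀) • E4.basisVector 0)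
  have h3 := h2.const_smul (√(2 * M / r₀ - 1))⁻¹
  refine h3.congr_fderiv ?_
  ext v i
  simp only [schwCylNormalDeriv, pow_one, Nat.cast_one, smul_apply, ContinuousLinearMap.comp_apply,
    add_apply, ContinuousLinearMap.id_apply, ContinuousLinearMap.smulRight_apply, E3.covec_apply,
    smul_eq_mul, map_add, map_smul, smul_smul, PiLp.smul_apply, PiLp.add_apply]

/-- The normal is differentiable off the origin. [folklore] -/
theorem differentiableAt_schwCylNormalRep (M r₀ : ℝ) {y : E3} (hy : y ≠ 0) :
    DifferentiableAt ℝ (schwCylNormalRep M r₀) y :=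
  (hasFDerivAt_schwCylNormalRep M r₀ hy).differentiableAt

/-- `Dν(y) = schwCylNormalDeriv M r₀ y` off the origin. [folklore] -/
theorem fderiv_schwCylNormalRep (M r₀ : ℝ) {y : E3} (hy : y ≠ 0) :
    fderiv ℝ (schwCylNormalRep M r₀) y = schwCylNormalDeriv M r₀ y :=
  (hasFDerivAt_schwCylNormalRep M r₀ hy).fderiv

/-- **The pointwise computation behind (4.1b)**: at `x = (‖y‖ + τ₀, r₀ y/‖y‖)`, with `Ṽ = dΦ v`,
`W̃ = dΦ w`, `N = ν(y)`, the coordinate expression of the second fundamental form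
`g(Dν v, W̃) + ½ (∂_Ṽ g(N, W̃) + ∂_N g(W̃, Ṽ) − ∂_W̃ g(Ṽ, N))` (`K = g(DN v + Γ(N)(Ṽ), W̃)` with the
first-kind Christoffel symbols of `g = η + (2M/r) ℓ ⊗ ℓ`) equals `kbarRep M r₀ y v w`. The three
Koszul terms are `2Mc Ω·‖y‖²…`-type expressions which cancel down to `−(2M/r₀²) c (1 − 2M/r₀) s(v)s(w)`,
`c = (2M/r₀ − 1)^{-1/2}`, and `g(Dν v, W̃) = c (1 − 2M/r₀) r₀ Ω(v, w)`. [cite: LiMei2020, (4.1)] -/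
theorem bilin_schwCylNormalDeriv_add_half_koszul (M : ℝ) {r₀ : ℝ} (hr₀ : 0 < r₀) (h2M : r₀ < 2 * M)
    (τ₀ : ℝ) {y : E3} (hy : y ≠ 0) (v w : E3) :
    Kerr.bilin M 0 (schwCylMap r₀ τ₀ y) (schwCylNormalDeriv M r₀ y v) (schwCylDeriv r₀ y w) +
      2⁻¹ * (fderiv ℝ (Kerr.bilin M 0) (schwCylMap r₀ τ₀ y) (schwCylDeriv r₀ y v)
            (schwCylNormalRep M r₀ y) (schwCylDeriv r₀ y w)
          + fderiv ℝ (Kerr.bilin M 0) (schwCylMap r₀ τ₀ y) (schwCylNormalRep M r₀ y)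
            (schwCylDeriv r₀ y w) (schwCylDeriv r₀ y v)
          - fderiv ℝ (Kerr.bilin M 0) (schwCylMap r₀ τ₀ y) (schwCylDeriv r₀ y w)
            (schwCylDeriv r₀ y v) (schwCylNormalRep M r₀ y)) =
      kbarRep M r₀ y v w := by
  have hn : ‖y‖ ≠ 0 := norm_ne_zero_iff.2 hy
  have hμ : 0 < 2 * M / r₀ - 1 := by
    rw [sub_pos, lt_div_iff₀ hr₀]; linarith
  have hs : √(2 * M / r₀ - 1) ^ 2 = 2 * M / r₀ - 1 := Real.sq_sqrt hμ.le
  have hs0 : √(2 * M / r₀ - 1) ≠ 0 := (Real.sqrt_pos.2 hμ).ne'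
  have hspv : E4.spatial (schwCylMap r₀ τ₀ y) ≠ 0 := spatial_schwCylMap_ne_zero hr₀.ne' τ₀ hy
  have hsp : E4.spatialNorm (schwCylMap r₀ τ₀ y) ≠ 0 := by
    rw [spatialNorm_schwCylMap hr₀ τ₀ hy]; exact hr₀.ne'
  rw [Schwarzschild.fderiv_bilin_zero_spin_apply M hspv, Schwarzschild.fderiv_bilin_zero_spin_apply M hspv,
    Schwarzschild.fderiv_bilin_zero_spin_apply M hspv, Kerr.bilin_zero_spin_apply M hsp]
  simp only [Schwarzschild.dG, Schwarzschild.dEll, Schwarzschild.ell, Schwarzschild.sdot,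
    spatialNorm_schwCylMap hr₀ τ₀ hy, schwCylDeriv_apply_zero, spatial_schwCylDeriv,
    spatial_schwCylMap, schwCylNormalRep_apply_zero, spatial_schwCylNormalRep,
    schwCylNormalDeriv_apply_zero, spatial_schwCylNormalDeriv, inner_add_left, inner_add_right,
    inner_smul_left, inner_smul_right, real_inner_self_eq_norm_sq, real_inner_comm v y,
    real_inner_comm w y, real_inner_comm w v, conj_trivial, kbarRep]
  set s := √(2 * M / r₀ - 1) with hs_def
  have hs' : s ^ 2 * r₀ = 2 * M - r₀ := by
    rw [hs]; field_simp
  field_simp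
  linear_combination (-(‖y‖ ^ 2 * (⟪w, y⟫ * ⟪v, y⟫) * M) + r₀ ^ 3 * ‖y‖ ^ 2 * ⟪w, v⟫
    - r₀ ^ 3 * (⟪w, y⟫ * ⟪v, y⟫)) * hs'

/-- **(4.1b), the second fundamental form of the pinned Schwarzschild cylinder frame.** For any map
`ψ : Kerr.slice 0 1 → Kerr.region 0 r₁` with `(ψ y : E4) = schwCylMap r₀ τ₀ y` and ANY future unit
normal `ν` of it (`0 ≤ M` for the time orientation, `0 < r₀ < 2M`; the frame of
`LiMei.NearSchwarzschildCylinder`), under the standing Levi-Civita hypothesis of the smooth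
Schwarzschild metric, `K_ν(ψ) = kbarRep M r₀`:
`k̄_M = M r₀⁻² (2M/r₀ − 1)^{1/2} dt² − r₀ (2M/r₀ − 1)^{1/2} dΩ²`, sign convention (h)
`K_ν(v, w) = + g(D_v ν, dψ w)`. Proof: `ν = schwCylNormalRep` (uniqueness), the coordinate formula
`OpensChart.secondFundamentalForm_eq_of_repr` with the first-kind Christoffel symbols
`g(Γ(N)(Ṽ), W̃) = ½ K(N, Ṽ, W̃)` (`OpensChart.val_christoffel_const`), and
`bilin_schwCylNormalDeriv_add_half_koszul`. Li–Mei arXiv:2005.01249, (4.1); O'Neill 1983, Ch. 4,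
Lemma 4.1 / 4.4; Wald 1984, (10.2.13). [cite: LiMei2020, (4.1)] -/
theorem secondFundamentalForm_schwCyl [Kerr.Facts] {M r₁ r₀ : ℝ}
    [(Kerr.smoothMetric M 0 r₁).HasLeviCivita] (hM : 0 ≤ M) (hr₀ : 0 < r₀) (h2M : r₀ < 2 * M)
    (τ₀ : ℝ) {ψ : Kerr.slice 0 1 → Kerr.region 0 r₁}
    (hψ : ∀ y, (ψ y : E4) = schwCylMap r₀ τ₀ (y : E3)) {ν : NormalField 𝓘(ℝ, E4) ψ}
    (hν : (Kerr.smoothMetric M 0 r₁).IsFutureUnitNormal 𝓘(ℝ, E3)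
      ((Kerr.timeOrientation M 0 r₁ hM).ofLE le_top) ψ ν)
    (y : Kerr.slice 0 1) (v w : E3) :
    (Kerr.smoothMetric M 0 r₁).secondFundamentalForm 𝓘(ℝ, E3) ψ ν y v w = kbarRep M r₀ y v w := by
  have hy : (y : E3) ≠ 0 := ne_zero_of_mem_slice y
  have hνrep : ∀ z : Kerr.slice 0 1, ν z = schwCylNormalRep M r₀ (z : E3) :=
    eq_schwCylNormalRep hM hr₀ h2M τ₀ hψ hν
  rw [OpensChart.secondFundamentalForm_eq_of_repr
    (g := (Kerr.smoothMetric M 0 r₁).toPseudoRiemannianMetric) (G := Kerr.bilin M 0)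
    (Kerr.smoothMetric_val M 0 r₁) hψ hνrep (differentiableAt_schwCylMap r₀ τ₀ hy)
    (differentiableAt_schwCylNormalRep M r₀ hy) (Kerr.differentiableAt_bilin M 0 _) v w,
    fderiv_schwCylMap r₀ τ₀ hy, fderiv_schwCylNormalRep M r₀ hy]
  -- the Christoffel symbols of the first kind: `g(Γ(N)(Ṽ), W̃) = ½ K(N, Ṽ, W̃)`
  have hΓ : Kerr.bilin M 0 (ψ y : E4) (OpensChart.christoffel
      (Kerr.smoothMetric M 0 r₁).toPseudoRiemannianMetric (Kerr.bilin M 0) (ψ y)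
      (schwCylNormalRep M r₀ (y : E3)) (schwCylDeriv r₀ (y : E3) v)) (schwCylDeriv r₀ (y : E3) w) =
      2⁻¹ * OpensChart.koszulForm (Kerr.bilin M 0) (ψ y : E4) (schwCylNormalRep M r₀ (y : E3))
        (schwCylDeriv r₀ (y : E3) v) (schwCylDeriv r₀ (y : E3) w) :=
    OpensChart.val_christoffel_const (g := (Kerr.smoothMetric M 0 r₁).toPseudoRiemannianMetric)
      (G := Kerr.bilin M 0) (ψ y) (schwCylNormalRep M r₀ (y : E3)) (schwCylDeriv r₀ (y : E3) v)
      (schwCylDeriv r₀ (y : E3) w)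
  -- read the pairing `g_{ψ y}` as the bilinear form `Kerr.bilin M 0 (ψ y)` on `E4`
  show Kerr.bilin M 0 (ψ y : E4) (schwCylNormalDeriv M r₀ (y : E3) v + OpensChart.christoffel
      (Kerr.smoothMetric M 0 r₁).toPseudoRiemannianMetric (Kerr.bilin M 0) (ψ y)
      (schwCylNormalRep M r₀ (y : E3)) (schwCylDeriv r₀ (y : E3) v)) (schwCylDeriv r₀ (y : E3) w) = _
  rw [map_add, add_apply, hΓ, OpensChart.koszulForm_apply, hψ y]
  exact bilin_schwCylNormalDeriv_add_half_koszul M hr₀ h2M τ₀ hy v w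


/-! ### §6 The hypothesis of Prop. 4.1 in closed form -/

/-- On `{1 < ‖z‖}` the model metric term of `LiMei.NearSchwarzschildCylinder` is `gbarRep M r₀ z`
(the `else` branch is not reached). [cite: LiMei2020, (4.1)] -/
theorem dite_pullbackBilin_eq [Kerr.Facts] {M r₁ r₀ : ℝ} (hr₀ : 0 < r₀) (τ₀ : ℝ)
    {ψ : Kerr.slice 0 1 → Kerr.region 0 r₁} (hψ : ∀ y, (ψ y : E4) = schwCylMap r₀ τ₀ (y : E3))
    (v w : E3) {z : E3} (hz : z ∈ Kerr.slice 0 1) [Decidable (z ∈ Kerr.slice 0 1)] :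
    (if hz : z ∈ Kerr.slice 0 1 then
        pullbackBilin (I := 𝓘(ℝ, E4)) (I' := 𝓘(ℝ, E3)) ψ (Kerr.smoothMetric M 0 r₁).val ⟨z, hz⟩ v w
      else 0) = gbarRep M r₀ z v w := by
  rw [dif_pos hz]
  exact pullbackBilin_schwCyl hr₀ τ₀ hψ ⟨z, hz⟩ v w

/-- On `{1 < ‖z‖}` the model second-fundamental-form term of `LiMei.NearSchwarzschildCylinder` is
`kbarRep M r₀ z`. [cite: LiMei2020, (4.1)] -/
theorem dite_secondFundamentalForm_eq [Kerr.Facts] {M r₁ r₀ : ℝ}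
    [(Kerr.smoothMetric M 0 r₁).HasLeviCivita] (hM : 0 ≤ M) (hr₀ : 0 < r₀) (h2M : r₀ < 2 * M)
    (τ₀ : ℝ) {ψ : Kerr.slice 0 1 → Kerr.region 0 r₁}
    (hψ : ∀ y, (ψ y : E4) = schwCylMap r₀ τ₀ (y : E3)) {ν : NormalField 𝓘(ℝ, E4) ψ}
    (hν : (Kerr.smoothMetric M 0 r₁).IsFutureUnitNormal 𝓘(ℝ, E3)
      ((Kerr.timeOrientation M 0 r₁ hM).ofLE le_top) ψ ν)
    (v w : E3) {z : E3} (hz : z ∈ Kerr.slice 0 1) [Decidable (z ∈ Kerr.slice 0 1)] :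
    (if hz : z ∈ Kerr.slice 0 1 then
        (Kerr.smoothMetric M 0 r₁).secondFundamentalForm 𝓘(ℝ, E3) ψ ν ⟨z, hz⟩ v w
      else 0) = kbarRep M r₀ z v w := by
  rw [dif_pos hz]
  exact secondFundamentalForm_schwCyl hM hr₀ h2M τ₀ hψ hν ⟨z, hz⟩ v w

/-- `{1 < ‖z‖} = Kerr.slice 0 1` is a neighbourhood of each of its points. [folklore] -/
theorem eventually_mem_slice_one {y : E3} (hy : 1 < ‖y‖) : ∀ᶠ z in 𝓝 y, z ∈ Kerr.slice 0 1 := by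
  have ho : IsOpen {z : E3 | 1 < ‖z‖} := isOpen_lt continuous_const continuous_norm
  filter_upwards [ho.mem_nhds hy] with z hz
  rw [Kerr.mem_slice_zero_iff, max_eq_left zero_le_one]
  exact hz

open scoped Classical in
/-- **The hypothesis of Li–Mei Prop. 4.1 in closed form.** For `0 < r₁ < r₀ < 2M` and `1 ≤ ρ₁`,
a datum `D` on `E3` is `ε`-close in sup-`C^k` on the annulus `{ρ₁ < ‖y‖ < ρ₂}` to the Schwarzschild(`M`)
cylinder `{r = r₀}` in the sense of `LiMei.NearSchwarzschildCylinder` (pinned frame, future unit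
normal, model terms `ψ^* g` and `K_ν(ψ)`) **iff** every Cartesian derivative of order `≤ k` of
`h(v, w) − gbarRep M r₀ (v, w)` and of `k(v, w) − kbarRep M r₀ (v, w)` has norm `≤ ε` there, on unit
test vectors: the frame clauses are discharged by the model frame (`isSpacelikeImmersion_schwCyl`,
`isFutureUnitNormal_schwCylNormal`), the normal is unique (`eq_schwCylNormalRep`), the model terms
are (4.1) (`pullbackBilin_schwCyl`, `secondFundamentalForm_schwCyl`) on the neighbourhood
`{1 < ‖z‖}` of the annulus, and iterated derivatives are local (`Filter.EventuallyEq.iteratedFDeriv`);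
the Levi-Civita binder is inhabited (`PseudoRiemannianMetric.hasLeviCivita`). This is the form in
which Li–Mei state the hypothesis: `‖(ḡ, k̄) − (ḡ_{m₀}, k̄_{m₀})‖ < ε` with `(ḡ_{m₀}, k̄_{m₀})` the
explicit tensors (4.1). Li–Mei arXiv:2005.01249, Prop. 4.1 and (4.1). [cite: LiMei2020, Prop. 4.1] -/
theorem nearSchwarzschildCylinder_iff [Kerr.Facts] {M r₁ r₀ ρ₁ ρ₂ : ℝ} {k : ℕ} {ε : ℝ}
    (hr₁ : r₁ < r₀) (hr₀ : 0 < r₀) (h2M : r₀ < 2 * M) (hρ₁ : 1 ≤ ρ₁)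
    (D : InitialDataSet (𝓡 3) E3) :
    NearSchwarzschildCylinder M r₁ r₀ ρ₁ ρ₂ k ε D ↔
      ∀ (v w : E3), ‖v‖ ≤ 1 → ‖w‖ ≤ 1 → ∀ i ≤ k, ∀ y : E3, ρ₁ < ‖y‖ → ‖y‖ < ρ₂ →
        ‖iteratedFDeriv ℝ i (fun z : E3 ↦ D.h.inner z v w - gbarRep M r₀ z v w) y‖ ≤ ε ∧
        ‖iteratedFDeriv ℝ i (fun z : E3 ↦ D.k z v w - kbarRep M r₀ z v w) y‖ ≤ ε := by
  have hM : 0 ≤ M := by linarith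
  haveI hLC : (Kerr.smoothMetric M 0 r₁).HasLeviCivita := PseudoRiemannianMetric.hasLeviCivita _
  constructor
  · rintro ⟨hM', ψ, ν, hψ, -, hν, H⟩ v w hv hw i hi y hy₁ hy₂
    have hy : 1 < ‖y‖ := lt_of_le_of_lt hρ₁ hy₁
    obtain ⟨Hh, Hk⟩ := H v w hv hw i hi y hy₁ hy₂
    have e₁ : (fun z : E3 ↦ D.h.inner z v w -
        (if hz : z ∈ Kerr.slice 0 1 then
          pullbackBilin (I := 𝓘(ℝ, E4)) (I' := 𝓘(ℝ, E3)) ψ (Kerr.smoothMetric M 0 r₁).val ⟨z, hz⟩ v w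
         else 0)) =ᶠ[𝓝 y] fun z : E3 ↦ D.h.inner z v w - gbarRep M r₀ z v w := by
      filter_upwards [eventually_mem_slice_one hy] with z hz
      rw [dite_pullbackBilin_eq hr₀ 0 hψ v w hz]
    have e₂ : (fun z : E3 ↦ D.k z v w -
        (if hz : z ∈ Kerr.slice 0 1 then
          (Kerr.smoothMetric M 0 r₁).secondFundamentalForm 𝓘(ℝ, E3) ψ ν ⟨z, hz⟩ v w
         else 0)) =ᶠ[𝓝 y] fun z : E3 ↦ D.k z v w - kbarRep M r₀ z v w := by
      filter_upwards [eventually_mem_slice_one hy] with z hz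
      rw [dite_secondFundamentalForm_eq hM' hr₀ h2M 0 hψ hν v w hz]
    refine ⟨?_, ?_⟩
    · rw [← (e₁.iteratedFDeriv ℝ i).eq_of_nhds]; exact Hh
    · rw [← (e₂.iteratedFDeriv ℝ i).eq_of_nhds]; exact Hk
  · intro H
    obtain ⟨ψ, hψ⟩ := exists_schwCylFrame (r₁ := r₁) hr₀ hr₁ 0
    refine ⟨hM, ψ, fun y ↦ schwCylNormalRep M r₀ (y : E3), hψ,
      isSpacelikeImmersion_schwCyl hr₀ h2M 0 hψ, isFutureUnitNormal_schwCylNormal hM hr₀ h2M 0 hψ,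
      fun v w hv hw i hi y hy₁ hy₂ ↦ ?_⟩
    have hy : 1 < ‖y‖ := lt_of_le_of_lt hρ₁ hy₁
    obtain ⟨Hh, Hk⟩ := H v w hv hw i hi y hy₁ hy₂
    refine ⟨?_, ?_⟩
    · have e₁ : (fun z : E3 ↦ D.h.inner z v w -
          (if hz : z ∈ Kerr.slice 0 1 then
            pullbackBilin (I := 𝓘(ℝ, E4)) (I' := 𝓘(ℝ, E3)) ψ (Kerr.smoothMetric M 0 r₁).val ⟨z, hz⟩ v w
           else 0)) =ᶠ[𝓝 y] fun z : E3 ↦ D.h.inner z v w - gbarRep M r₀ z v w := by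
        filter_upwards [eventually_mem_slice_one hy] with z hz
        rw [dite_pullbackBilin_eq hr₀ 0 hψ v w hz]
      rw [(e₁.iteratedFDeriv ℝ i).eq_of_nhds]; exact Hh
    · intro inst
      have e₂ : (fun z : E3 ↦ D.k z v w -
          (if hz : z ∈ Kerr.slice 0 1 then
            (Kerr.smoothMetric M 0 r₁).secondFundamentalForm 𝓘(ℝ, E3) ψ
              (fun y ↦ schwCylNormalRep M r₀ (y : E3)) ⟨z, hz⟩ v w
           else 0)) =ᶠ[𝓝 y] fun z : E3 ↦ D.k z v w - kbarRep M r₀ z v w := by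
        filter_upwards [eventually_mem_slice_one hy] with z hz
        rw [dite_secondFundamentalForm_eq hM hr₀ h2M 0 hψ
          (isFutureUnitNormal_schwCylNormal hM hr₀ h2M 0 hψ) v w hz]
      rw [(e₂.iteratedFDeriv ℝ i).eq_of_nhds]; exact Hk


/-! ### §7 Rotated frames: the zero-spin Kerr cylinder `kerrCylMap r₀ 0 τ₀ R = schwCylMap r₀ τ₀ ∘ R` -/

/-- `gbarRep` is rotation invariant: `ḡ(Ry)(Rv, Rw) = ḡ(y)(v, w)` for a linear isometry `R`
(spherical symmetry of the Schwarzschild cylinder data). [cite: LiMei2020, (4.1)] -/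
theorem gbarRep_isometry (M r₀ : ℝ) (R : E3 →ₗᵢ[ℝ] E3) (y v w : E3) :
    gbarRep M r₀ (R y) (R v) (R w) = gbarRep M r₀ y v w := by
  simp only [gbarRep, LinearIsometry.inner_map_map, LinearIsometry.norm_map]

/-- `kbarRep` is rotation invariant. [cite: LiMei2020, (4.1)] -/
theorem kbarRep_isometry (M r₀ : ℝ) (R : E3 →ₗᵢ[ℝ] E3) (y v w : E3) :
    kbarRep M r₀ (R y) (R v) (R w) = kbarRep M r₀ y v w := by
  simp only [kbarRep, LinearIsometry.inner_map_map, LinearIsometry.norm_map]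

/-- **At zero spin the standard Kerr cylinder map is the rotated Schwarzschild cylinder map**:
`kerrCylMap r₀ 0 τ₀ R y = schwCylMap r₀ τ₀ (R y)` (`0 ≤ r₀`; `ellipsoidPt r₀ 0 n = r₀ n`,
`R (y/‖y‖) = Ry/‖Ry‖`). This is how `LiMei.IsKerrCylinderOn m 0 r₀ τ₀ R` reads. [folklore] -/
theorem kerrCylMap_zero_spin {r₀ : ℝ} (hr₀ : 0 ≤ r₀) (τ₀ : ℝ) (R : E3 →ₗᵢ[ℝ] E3) (y : E3) :
    kerrCylMap r₀ 0 τ₀ R y = schwCylMap r₀ τ₀ (R y) := by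
  have hell : ∀ n : E3, ellipsoidPt r₀ 0 n = r₀ • n := fun n ↦ by
    ext i
    fin_cases i <;> simp [ellipsoidPt, Real.sqrt_sq hr₀]
  rw [kerrCylMap, schwCylMap, hell, LinearIsometry.norm_map, map_smul, smul_smul, div_eq_mul_inv]

/-- The rotated cylinder map has differential `schwCylDeriv r₀ (R y) ∘ R` off the origin. [folklore] -/
theorem hasFDerivAt_schwCylMap_comp (r₀ τ₀ : ℝ) (R : E3 →ₗᵢ[ℝ] E3) {y : E3} (hy : y ≠ 0) :
    HasFDerivAt (fun z : E3 ↦ schwCylMap r₀ τ₀ (R z))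
      ((schwCylDeriv r₀ (R y)).comp R.toContinuousLinearMap) y := by
  have hRy : R y ≠ 0 := fun h ↦ hy (by
    have := congrArg norm h; rwa [LinearIsometry.norm_map, norm_zero, norm_eq_zero] at this)
  exact (hasFDerivAt_schwCylMap r₀ τ₀ hRy).comp y R.toContinuousLinearMap.hasFDerivAt

/-- The rotated normal `y ↦ ν(Ry)` has differential `schwCylNormalDeriv M r₀ (R y) ∘ R` off the
origin. [folklore] -/
theorem hasFDerivAt_schwCylNormalRep_comp (M r₀ : ℝ) (R : E3 →ₗᵢ[ℝ] E3) {y : E3} (hy : y ≠ 0) :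
    HasFDerivAt (fun z : E3 ↦ schwCylNormalRep M r₀ (R z))
      ((schwCylNormalDeriv M r₀ (R y)).comp R.toContinuousLinearMap) y := by
  have hRy : R y ≠ 0 := fun h ↦ hy (by
    have := congrArg norm h; rwa [LinearIsometry.norm_map, norm_zero, norm_eq_zero] at this)
  exact (hasFDerivAt_schwCylNormalRep M r₀ hRy).comp y R.toContinuousLinearMap.hasFDerivAt

section Rotated

variable [Kerr.Facts] {M r₁ r₀ τ₀ : ℝ} {R : E3 →ₗᵢ[ℝ] E3} {ψ : Kerr.slice 0 1 → Kerr.region 0 r₁}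

omit [Kerr.Facts] in
/-- Points of the slice stay off the origin under a linear isometry. [folklore] -/
theorem isometry_ne_zero_of_mem_slice (R : E3 →ₗᵢ[ℝ] E3) (y : Kerr.slice 0 1) : R (y : E3) ≠ 0 :=
  fun h ↦ ne_zero_of_mem_slice y (by
    have := congrArg norm h; rwa [LinearIsometry.norm_map, norm_zero, norm_eq_zero] at this)

omit [Kerr.Facts] in
/-- The differential of a rotated pinned frame: `dψ v = schwCylDeriv r₀ (Ry) (Rv)`. [folklore] -/
theorem mfderiv_schwCyl_comp_apply (hψ : ∀ y, (ψ y : E4) = schwCylMap r₀ τ₀ (R (y : E3)))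
    (y : Kerr.slice 0 1) (v : E3) :
    mfderiv 𝓘(ℝ, E3) 𝓘(ℝ, E4) ψ y v = schwCylDeriv r₀ (R (y : E3)) (R v) := by
  have hd := hasFDerivAt_schwCylMap_comp r₀ τ₀ R (ne_zero_of_mem_slice y)
  rw [OpensChart.mfderiv_apply_of_repr (Φ := fun z : E3 ↦ schwCylMap r₀ τ₀ (R z)) hψ
    hd.differentiableAt, hd.fderiv]
  rfl

/-- **(4.1a) for rotated frames**: for `(ψ y : E4) = schwCylMap r₀ τ₀ (R y)` (in particular for the
zero-spin Kerr cylinder frame `kerrCylMap r₀ 0 τ₀ R`, `kerrCylMap_zero_spin`),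
`ψ^* g_{M,0} = gbarRep M r₀` — by (4.1a) at the point `Ry` and rotation invariance. Li–Mei
arXiv:2005.01249, (4.1). [cite: LiMei2020, (4.1)] -/
theorem pullbackBilin_schwCyl_comp (hr₀ : 0 < r₀)
    (hψ : ∀ y, (ψ y : E4) = schwCylMap r₀ τ₀ (R (y : E3))) (y : Kerr.slice 0 1) (v w : E3) :
    pullbackBilin (I := 𝓘(ℝ, E4)) (I' := 𝓘(ℝ, E3)) ψ (Kerr.smoothMetric M 0 r₁).val y v w =
      gbarRep M r₀ y v w := by
  rw [pullbackBilin_apply, mfderiv_schwCyl_comp_apply hψ, mfderiv_schwCyl_comp_apply hψ,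
    Kerr.smoothMetric_val, hψ y]
  exact (bilin_schwCylDeriv M hr₀ τ₀ (isometry_ne_zero_of_mem_slice R y) (R v) (R w)).trans
    (gbarRep_isometry M r₀ R y v w)

omit [Kerr.Facts] in
/-- A rotated pinned frame is `C^n` for every `n`. [folklore] -/
theorem contMDiff_schwCyl_comp (hψ : ∀ y, (ψ y : E4) = schwCylMap r₀ τ₀ (R (y : E3))) (n : ℕ∞ω) :
    ContMDiff 𝓘(ℝ, E3) 𝓘(ℝ, E4) n ψ := fun y ↦
  (ChartedSpace.liftPropWithinAt_subtypeVal_comp_iff ψ Set.univ y).mp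
    ((OpensChart.contMDiffAt_iff y (Subtype.val ∘ ψ) (fun z : E3 ↦ schwCylMap r₀ τ₀ (R z))
      (fun z ↦ hψ z)).2 ((contDiffAt_schwCylMap r₀ τ₀ (isometry_ne_zero_of_mem_slice R y)).comp
        (y : E3) R.toContinuousLinearMap.contDiff.contDiffAt))

/-- **A rotated Schwarzschild cylinder frame is a smooth spacelike immersion** (`0 < r₀ < 2M`).
Li–Mei arXiv:2005.01249, §4, p. 22. [cite: LiMei2020, §4] -/
theorem isSpacelikeImmersion_schwCyl_comp (hr₀ : 0 < r₀) (h2M : r₀ < 2 * M)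
    (hψ : ∀ y, (ψ y : E4) = schwCylMap r₀ τ₀ (R (y : E3))) :
    (Kerr.smoothMetric M 0 r₁).IsSpacelikeImmersion 𝓘(ℝ, E3) ψ := by
  refine ⟨contMDiff_schwCyl_comp hψ _, fun y v hv ↦ ?_⟩
  have h := pullbackBilin_schwCyl_comp (M := M) hr₀ hψ y v v
  rw [pullbackBilin_apply] at h
  rw [PseudoRiemannianMetric.inducedBilin_apply]
  exact h ▸ gbarRep_pos hr₀ h2M (ne_zero_of_mem_slice y) hv

/-- **The future unit normal of a rotated Schwarzschild cylinder frame is `y ↦ ν(Ry)`**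
(`0 ≤ M`, `0 < r₀ < 2M`). [cite: LiMei2020, (4.1)] -/
theorem isFutureUnitNormal_schwCylNormal_comp (hM : 0 ≤ M) (hr₀ : 0 < r₀) (h2M : r₀ < 2 * M)
    (hψ : ∀ y, (ψ y : E4) = schwCylMap r₀ τ₀ (R (y : E3))) :
    (Kerr.smoothMetric M 0 r₁).IsFutureUnitNormal 𝓘(ℝ, E3)
      ((Kerr.timeOrientation M 0 r₁ hM).ofLE le_top) ψ
      (fun y ↦ schwCylNormalRep M r₀ (R (y : E3))) := by
  have hunit : ∀ y : Kerr.slice 0 1, (Kerr.smoothMetric M 0 r₁).val (ψ y)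
      (schwCylNormalRep M r₀ (R (y : E3))) (schwCylNormalRep M r₀ (R (y : E3))) = -1 := fun y ↦ by
    rw [Kerr.smoothMetric_val, hψ y]
    exact bilin_schwCylNormalRep_self M hr₀ h2M τ₀ (isometry_ne_zero_of_mem_slice R y)
  refine ⟨⟨fun y v ↦ ?_, hunit⟩, fun y ↦ ⟨?_, ?_⟩⟩
  · rw [mfderiv_schwCyl_comp_apply hψ, Kerr.smoothMetric_val, hψ y]
    exact bilin_schwCylNormalRep_schwCylDeriv M hr₀ τ₀ (isometry_ne_zero_of_mem_slice R y) (R v)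
  · have ht : (Kerr.smoothMetric M 0 r₁).IsTimelike (x := ψ y)
        (schwCylNormalRep M r₀ (R (y : E3))) := by
      rw [LorentzianMetric.isTimelike_iff]
      exact (hunit y) ▸ neg_one_lt_zero
    exact ht.isCausal
  · rw [TimeOrientation.vectorField_ofLE, Kerr.smoothMetric_val]
    show Kerr.bilin M 0 (ψ y : E4) (Kerr.timeVector M 0 (ψ y : E4))
      (schwCylNormalRep M r₀ (R (y : E3))) < 0
    rw [hψ y]
    exact bilin_timeVector_schwCylNormalRep hr₀ h2M τ₀ (isometry_ne_zero_of_mem_slice R y)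

/-- Every future unit normal of a rotated Schwarzschild cylinder frame is `y ↦ ν(Ry)` (uniqueness).
[cite: LiMei2020, (4.1)] -/
theorem eq_schwCylNormalRep_comp (hM : 0 ≤ M) (hr₀ : 0 < r₀) (h2M : r₀ < 2 * M)
    (hψ : ∀ y, (ψ y : E4) = schwCylMap r₀ τ₀ (R (y : E3))) {ν : NormalField 𝓘(ℝ, E4) ψ}
    (hν : (Kerr.smoothMetric M 0 r₁).IsFutureUnitNormal 𝓘(ℝ, E3)
      ((Kerr.timeOrientation M 0 r₁ hM).ofLE le_top) ψ ν) (y : Kerr.slice 0 1) :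
    ν y = schwCylNormalRep M r₀ (R (y : E3)) :=
  (isFutureUnitNormal_schwCylNormal_comp hM hr₀ h2M hψ).apply_eq finrank_E4_eq
    (isSpacelikeImmersion_schwCyl_comp hr₀ h2M hψ) hν y

/-- **(4.1b) for rotated frames**: for `(ψ y : E4) = schwCylMap r₀ τ₀ (R y)` and any future unit
normal `ν`, `K_ν(ψ) = kbarRep M r₀` — the coordinate formula at the point `Ry` with the vectors
`Rv`, `Rw` (`bilin_schwCylNormalDeriv_add_half_koszul`) and rotation invariance of `kbarRep`.
Li–Mei arXiv:2005.01249, (4.1). [cite: LiMei2020, (4.1)] -/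
theorem secondFundamentalForm_schwCyl_comp [(Kerr.smoothMetric M 0 r₁).HasLeviCivita]
    (hM : 0 ≤ M) (hr₀ : 0 < r₀) (h2M : r₀ < 2 * M)
    (hψ : ∀ y, (ψ y : E4) = schwCylMap r₀ τ₀ (R (y : E3))) {ν : NormalField 𝓘(ℝ, E4) ψ}
    (hν : (Kerr.smoothMetric M 0 r₁).IsFutureUnitNormal 𝓘(ℝ, E3)
      ((Kerr.timeOrientation M 0 r₁ hM).ofLE le_top) ψ ν)
    (y : Kerr.slice 0 1) (v w : E3) :
    (Kerr.smoothMetric M 0 r₁).secondFundamentalForm 𝓘(ℝ, E3) ψ ν y v w = kbarRep M r₀ y v w := by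
  have hy : (y : E3) ≠ 0 := ne_zero_of_mem_slice y
  have hRy : R (y : E3) ≠ 0 := isometry_ne_zero_of_mem_slice R y
  have hνrep : ∀ z : Kerr.slice 0 1, ν z = schwCylNormalRep M r₀ (R (z : E3)) :=
    eq_schwCylNormalRep_comp hM hr₀ h2M hψ hν
  have hΦ := hasFDerivAt_schwCylMap_comp r₀ τ₀ R hy
  have hN := hasFDerivAt_schwCylNormalRep_comp M r₀ R hy
  rw [OpensChart.secondFundamentalForm_eq_of_repr
    (g := (Kerr.smoothMetric M 0 r₁).toPseudoRiemannianMetric) (G := Kerr.bilin M 0)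
    (Kerr.smoothMetric_val M 0 r₁) (Φ := fun z : E3 ↦ schwCylMap r₀ τ₀ (R z)) hψ
    (N := fun z : E3 ↦ schwCylNormalRep M r₀ (R z)) hνrep hΦ.differentiableAt hN.differentiableAt
    (Kerr.differentiableAt_bilin M 0 _) v w, hΦ.fderiv, hN.fderiv]
  have hΓ : Kerr.bilin M 0 (ψ y : E4) (OpensChart.christoffel
      (Kerr.smoothMetric M 0 r₁).toPseudoRiemannianMetric (Kerr.bilin M 0) (ψ y)
      (schwCylNormalRep M r₀ (R (y : E3))) (schwCylDeriv r₀ (R (y : E3)) (R v)))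
      (schwCylDeriv r₀ (R (y : E3)) (R w)) =
      2⁻¹ * OpensChart.koszulForm (Kerr.bilin M 0) (ψ y : E4) (schwCylNormalRep M r₀ (R (y : E3)))
        (schwCylDeriv r₀ (R (y : E3)) (R v)) (schwCylDeriv r₀ (R (y : E3)) (R w)) :=
    OpensChart.val_christoffel_const (g := (Kerr.smoothMetric M 0 r₁).toPseudoRiemannianMetric)
      (G := Kerr.bilin M 0) (ψ y) _ _ _
  show Kerr.bilin M 0 (ψ y : E4) (schwCylNormalDeriv M r₀ (R (y : E3)) (R v) +
      OpensChart.christoffel (Kerr.smoothMetric M 0 r₁).toPseudoRiemannianMetric (Kerr.bilin M 0)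
        (ψ y) (schwCylNormalRep M r₀ (R (y : E3))) (schwCylDeriv r₀ (R (y : E3)) (R v)))
      (schwCylDeriv r₀ (R (y : E3)) (R w)) = _
  rw [map_add, add_apply, hΓ, OpensChart.koszulForm_apply, hψ y, ← kbarRep_isometry M r₀ R]
  exact bilin_schwCylNormalDeriv_add_half_koszul M hr₀ h2M τ₀ hRy (R v) (R w)

end Rotated

/-- **Exact zero-spin Kerr-cylinder data in closed form.** If `D` is exactly the Kerr(`m, 0`)
cylinder datum `{r = r₀}` on `s` in standard form with axis rotation `R` and time shift `τ₀`
(`LiMei.IsKerrCylinderOn m 0 r₀ τ₀ R s D`), and `0 < r₀ < 2m`, then on `s ∩ {1 < ‖y‖}` its metric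
and second fundamental form ARE the tensors (4.1): `h = gbarRep m r₀`, `k = kbarRep m r₀` (the
rotation and the shift drop out by the symmetries of the Schwarzschild cylinder). Li–Mei
arXiv:2005.01249, (4.1) and Prop. 4.1 (the case `a⃗ = 0` of "(g̃, π̃) = (ḡ_{m,a⃗}, π̄_{m,a⃗}) near `t₂`").
[cite: LiMei2020, (4.1)] -/
theorem IsKerrCylinderOn.eq_gbarRep_kbarRep_of_zero_spin [Kerr.Facts] {m r₀ τ₀ : ℝ}
    {R : E3 →ₗᵢ[ℝ] E3} {s : Set E3} {D : InitialDataSet (𝓡 3) E3} (hr₀ : 0 < r₀)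
    (h2m : r₀ < 2 * m) (hK : IsKerrCylinderOn m 0 r₀ τ₀ R s D) (y : Kerr.slice 0 1)
    (hy : (y : E3) ∈ s) (v w : E3) :
    D.h.inner (y : E3) v w = gbarRep m r₀ y v w ∧ D.k (y : E3) v w = kbarRep m r₀ y v w := by
  obtain ⟨r₁, hm, ψ, ν, -, hψ, -, hν, hh, hk⟩ := hK
  have hψ' : ∀ z : Kerr.slice 0 1, (ψ z : E4) = schwCylMap r₀ τ₀ (R (z : E3)) := fun z ↦ by
    rw [hψ z, kerrCylMap_zero_spin hr₀.le τ₀ R]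
  haveI : (Kerr.smoothMetric m 0 r₁).HasLeviCivita := PseudoRiemannianMetric.hasLeviCivita _
  refine ⟨?_, ?_⟩
  · rw [hh y hy]
    exact pullbackBilin_schwCyl_comp hr₀ hψ' y v w
  · have e := LinearMap.congr_fun₂ (hk y hy) v w
    exact e.trans (secondFundamentalForm_schwCyl_comp hm hr₀ h2m hψ' hν y v w)

end LiMei

end Literature.Geometry.Lorentzian

end
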